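import Mathlib
import Summits.NavierStokesRegularity.NavierStokesRegularity.Theorems.FilamentSkeletonRssDefectColumnGateColumnVorticity

/-!
# Route `FilamentSkeletonRss` · crux `TransverseReduction1AG` (stmt-NavierStokesRegularity-27853) · line `defect_column_gate_1AG` —
# S2a `WaistColumnGate1A` IS FALSE MODULO THE FAR-FIELD QUASIMODES (conditional refutation of the superseded stub)

Helper file (`--supports stmt-NavierStokesRegularity-27853 --as helper`; LEAD of 27853, lane ns-filament-21221-p1 g10).  The lead's memo
`S2A-FALSE-FARFIELD-27853-g10.md` (evidence #25/#28 on stmt-27853) shows on paper that the registered stub S2a `WaistColumnGate1A` (Defs §4) is false as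
typed: for a frame gradient `B` whose sectional strain asymmetry exceeds `gam/4` the frozen sectional operator has moment-free quasimodes escaping to
infinity in the section at FIXED circulation `Rc`.  This file isolates the analytic input as ONE named proposition and kernel-checks the logical
reduction:

* `FarFieldQuasimodes1A` — the CONSTRUCTION still owed (a cdisprove / stub-worker target, explicit recipe in the memo §6): a frame gradient `B` in the box
  `(δ, Λ, θ₀) = (1/10, 10, 1)` (axis `e₃`, `B e₃ = κe₃`, sectional trace `3/2 − κ`, `‖B‖ ≤ 10`) such that for every `Rc ≥ 1` and every `ε > 0` there is
  an admissible perturbation `W` (C³, solenoidal, finite sectional size, moment-free axial vorticity at every station) with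
  `⟨ξ⟩⁴|colForceVort B 0 (κ−3/2) Rc e₃ W| ≤ ε` everywhere and `⟨ξ⟩⁴|curl W| ≥ 1` somewhere;
* `colForceVort_const_smul`, `contDiff_one_lerayLin` — the S2a operator is homogeneous in `W`;
* **`not_waistColumnGate1A_of_farFieldQuasimodes : FarFieldQuasimodes1A → ¬ WaistColumnGate1A`** — scaling `W ↦ ε⁻¹W` with `ε = 1/(2·C·Rc^q)` turns
  the quasimode into a counterexample to any asserted constant `C·Rc^q`.

HONEST FRAMING: MODEL rung, negative side; this refutes (conditionally) an INSTRUMENT of the line — the superseded stub S2a, already replaced by the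
localised S2a-loc `WaistColumnGateLoc1A` in skeleton v4 — not the crux; `TransverseReduction1AG` is neither proved nor refuted; nothing here bears on
Navier–Stokes regularity.
-/

set_option linter.dupNamespace false

noncomputable section

namespace Summit.NavierStokesRegularity.NavierStokesRegularity.Theorems.DefectColumnGate

open scoped BigOperators Topology InnerProductSpace Laplacian ContDiff
open Set Function MeasureTheory
open Literature.Analysis.FluidPDE
open Summit.NavierStokesRegularity.NavierStokesRegularity.Theorems.KelvinGate

/-! ## 1. The owed construction, as a named proposition -/

/-- **The far-field quasimodes of the frozen sectional operator (construction owed; memo §3/§6).**  In the parameter box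
`(δ, Λ, θ₀) = (1/10, 10, 1)`, with axis `d = e₃` and normal frame `(e₁, e₂)`: a frame gradient `B` with `3/2 + 1/10 ≤ κ ≤ 10`, `B e₃ = κ e₃`,
`⟨Be₁,e₁⟩ + ⟨Be₂,e₂⟩ = 3/2 − κ`, `‖B‖ ≤ 10` (the memo's witness: `κ = 8/5`, `B = diag(1/5, −3/10, 8/5)`), such that at rate `α = 0`, for every
circulation `Rc ≥ 1` and every `ε > 0`, some perturbation `W` in the class of `WaistColumnGate1A` (C³, solenoidal, finite sectional size, axial vorticity
with zero sectional mass and first moments at every station) has `⟨ξ⟩⁴|colForceVort B 0 (κ − 3/2) Rc e₃ W| ≤ ε` at every point and `⟨ξ⟩⁴|curl W| ≥ 1` at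
some point (the memo's `W_D = ∇Ψ_D × e₃`, `Ψ_D = χ(log x₁/log D)x₁^{-4}e^{−λ₂x₂²/2}`, `D → ∞`). -/
def FarFieldQuasimodes1A : Prop :=
  ∃ (B : EuclideanSpace ℝ (Fin 3) →L[ℝ] EuclideanSpace ℝ (Fin 3)) (κ : ℝ),
    (3/2 + 1/10 ≤ κ ∧ κ ≤ 10 ∧ B (EuclideanSpace.single 2 1) = κ • EuclideanSpace.single 2 1 ∧
      ⟪B (EuclideanSpace.single 0 1), EuclideanSpace.single 0 1⟫_ℝ + ⟪B (EuclideanSpace.single 1 1), EuclideanSpace.single 1 1⟫_ℝ = 3/2 - κ ∧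
      ‖B‖ ≤ 10) ∧
    ∀ Rc : ℝ, 1 ≤ Rc → ∀ ε : ℝ, 0 < ε →
      ∃ W : EuclideanSpace ℝ (Fin 3) → EuclideanSpace ℝ (Fin 3), ContDiff ℝ 3 W ∧ VectorCalculus.IsDivFree W ∧
        (∃ A : ℝ, ∀ y, secWt (EuclideanSpace.single 2 1) y * ‖W y‖ ≤ A ∧ secWt (EuclideanSpace.single 2 1) y ^ 2 * ‖curl W y‖ ≤ A) ∧
        (∀ τ : ℝ,
          (∫ ξ : EuclideanSpace ℝ (Fin 2),
              ⟪curl W (secPt (EuclideanSpace.single 2 1) (EuclideanSpace.single 0 1) (EuclideanSpace.single 1 1) τ ξ), EuclideanSpace.single 2 1⟫_ℝ = 0) ∧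
          (∫ ξ : EuclideanSpace ℝ (Fin 2),
              ξ 0 * ⟪curl W (secPt (EuclideanSpace.single 2 1) (EuclideanSpace.single 0 1) (EuclideanSpace.single 1 1) τ ξ), EuclideanSpace.single 2 1⟫_ℝ = 0) ∧
          (∫ ξ : EuclideanSpace ℝ (Fin 2),
              ξ 1 * ⟪curl W (secPt (EuclideanSpace.single 2 1) (EuclideanSpace.single 0 1) (EuclideanSpace.single 1 1) τ ξ), EuclideanSpace.single 2 1⟫_ℝ = 0)) ∧
        (∀ y, secWt (EuclideanSpace.single 2 1) y ^ 2 * ‖colForceVort B 0 (κ - 3/2) Rc (EuclideanSpace.single 2 1) W y‖ ≤ ε) ∧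
        (∃ y₀, 1 ≤ secWt (EuclideanSpace.single 2 1) y₀ ^ 2 * ‖curl W y₀‖)

/-! ## 2. Homogeneity of the S2a operator in the perturbation -/

/-- `𝓛_(α,U⁰) W ∈ C¹` for `U⁰ ∈ C²`, `W ∈ C³`. -/
theorem contDiff_one_lerayLin (α : ℝ) {U0 W : EuclideanSpace ℝ (Fin 3) → EuclideanSpace ℝ (Fin 3)} (hU : ContDiff ℝ 2 U0)
    (hW : ContDiff ℝ 3 W) : ContDiff ℝ 1 (fun z => lerayLin α U0 W z) := by
  have hPc : ContDiff ℝ 1 (fderiv ℝ W) := hW.fderiv_right (m := 1) (by norm_num)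
  have hPUc : ContDiff ℝ 1 (fderiv ℝ U0) := hU.fderiv_right (m := 1) (by norm_num)
  have hW1 : ContDiff ℝ 1 W := hW.of_le (by norm_num)
  have hU1 : ContDiff ℝ 1 U0 := hU.of_le (by norm_num)
  have hJc : ContDiff ℝ 1 (fun y : EuclideanSpace ℝ (Fin 3) => cross (EuclideanSpace.single 2 1) y) := by
    simp only [cross_single_two_eq_rotGenL]; exact rotGenL.contDiff
  have hJW : ContDiff ℝ 1 (fun z => cross (EuclideanSpace.single 2 1) (W z)) := by
    simp only [cross_single_two_eq_rotGenL]; exact rotGenL.contDiff.comp hW1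
  have e : (fun z => lerayLin α U0 W z) = fun z =>
      α • (cross (EuclideanSpace.single 2 1) (W z) - fderiv ℝ W z (cross (EuclideanSpace.single 2 1) z))
        + (1/2:ℝ) • W z + (1/2:ℝ) • fderiv ℝ W z z - (Δ W) z + fderiv ℝ W z (U0 z) + fderiv ℝ U0 z (W z) := by
    funext z; simp only [lerayLin]
  rw [e]
  exact ((((((hJW.sub (hPc.clm_apply hJc)).const_smul α).add (hW1.const_smul _)).add ((hPc.clm_apply contDiff_id).const_smul _)).sub
    (KelvinGate.contDiff_one_laplacian hW)).add (hPc.clm_apply hU1)).add (hPUc.clm_apply hW1)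

/-- `𝓛_(α,U⁰)` of the zero field is zero. -/
theorem lerayLin_zero (α : ℝ) (U0 : EuclideanSpace ℝ (Fin 3) → EuclideanSpace ℝ (Fin 3)) (y : EuclideanSpace ℝ (Fin 3)) :
    lerayLin α U0 (fun _ => (0 : EuclideanSpace ℝ (Fin 3))) y = 0 := by
  have hΔ : (Δ (fun _ : EuclideanSpace ℝ (Fin 3) => (0 : EuclideanSpace ℝ (Fin 3)))) y = 0 := by
    rw [KelvinGate.laplacian_eq_sum_fderiv_fderiv]
    simp
  have hc : cross (EuclideanSpace.single (2 : Fin 3) (1:ℝ)) (0 : EuclideanSpace ℝ (Fin 3)) = 0 := by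
    rw [cross_single_two_eq_rotGenL, map_zero]
  simp [lerayLin, hΔ, hc]

/-- **Homogeneity of the linearised operator**: `𝓛(c·W)(y) = c·𝓛W(y)` for `W ∈ C²`. -/
theorem lerayLin_const_smul (α c : ℝ) (U0 : EuclideanSpace ℝ (Fin 3) → EuclideanSpace ℝ (Fin 3)) {W : EuclideanSpace ℝ (Fin 3) → EuclideanSpace ℝ (Fin 3)}
    (hW : ContDiff ℝ 2 W) (y : EuclideanSpace ℝ (Fin 3)) :
    lerayLin α U0 (fun z => c • W z) y = c • lerayLin α U0 W y := by
  have h := lerayLin_add_smul α c U0 (fun _ => 0) W y contDiffAt_const hW.contDiffAt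
  simp only [zero_add] at h
  rw [h, lerayLin_zero, zero_add]

/-- **Homogeneity of the S2a operator**: `colForceVort(c·W) = c·colForceVort(W)` for `W ∈ C³` (any model data). -/
theorem colForceVort_const_smul (B : EuclideanSpace ℝ (Fin 3) →L[ℝ] EuclideanSpace ℝ (Fin 3)) (α gam Rc c : ℝ) (d : EuclideanSpace ℝ (Fin 3))
    {W : EuclideanSpace ℝ (Fin 3) → EuclideanSpace ℝ (Fin 3)} (hW : ContDiff ℝ 3 W) (y : EuclideanSpace ℝ (Fin 3)) :
    colForceVort B α gam Rc d (fun z => c • W z) y = c • colForceVort B α gam Rc d W y := by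
  unfold colForceVort
  have e : (fun z => lerayLin α (colBase B α gam Rc d) (fun z => c • W z) z) = fun z => c • lerayLin α (colBase B α gam Rc d) W z :=
    funext fun z => lerayLin_const_smul α c _ (hW.of_le (by norm_num)) z
  rw [e]
  exact curl_const_smul (((contDiff_one_lerayLin α (contDiff_colBase B α gam Rc d) hW).differentiable (by norm_num)) y) c

/-! ## 3. The conditional refutation -/

/-- The frame `(e₃; e₁, e₂)` is orthonormal. -/
theorem orthonormal_e3_e1_e2 :
    Orthonormal ℝ ![EuclideanSpace.single (2 : Fin 3) (1:ℝ), EuclideanSpace.single 0 1, EuclideanSpace.single 1 1] := by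
  have h := (EuclideanSpace.orthonormal_single (𝕜 := ℝ) (ι := Fin 3)).comp (![(2 : Fin 3), 0, 1]) (by decide)
  convert h using 1
  funext i
  fin_cases i <;> rfl

/-- **S2a `WaistColumnGate1A` is false, modulo the far-field quasimodes.**  Given the construction `FarFieldQuasimodes1A`, the asserted uniform bound
`⟨ξ⟩⁴|curl W| ≤ C·Rc^q` fails: at `Rc = max R₀ 1`, rescale a quasimode with `ε = 1/(2·C·Rc^q)` by `ε⁻¹` — its forcing is then `≤ 1` in the S2a norm
while its weighted vorticity reaches `2·C·Rc^q` somewhere. -/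
theorem not_waistColumnGate1A_of_farFieldQuasimodes (h : FarFieldQuasimodes1A) : ¬ WaistColumnGate1A := by
  intro hS
  obtain ⟨B, κ, ⟨hκ1, hκ2, hBd, htr, hB⟩, hQ⟩ := h
  obtain ⟨R₀, q, C, hC, hgate⟩ := hS (1/10) 10 1 (by norm_num) (by norm_num) (by norm_num)
  set Rc : ℝ := max R₀ 1 with hRc_def
  have hRc : R₀ ≤ Rc := le_max_left _ _
  have hRc1 : 1 ≤ Rc := le_max_right _ _
  have hCR : 0 < C * Rc ^ q := mul_pos hC (Real.rpow_pos_of_pos (by linarith) _)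
  set ε : ℝ := 1 / (2 * (C * Rc ^ q)) with hε_def
  have hε : 0 < ε := by rw [hε_def]; positivity
  obtain ⟨W, hW3, hdiv, ⟨A, hA⟩, hmom, hforce, ⟨y₀, hy₀⟩⟩ := hQ Rc hRc1 ε hε
  -- the rescaled quasimode
  have hW1 : Differentiable ℝ W := hW3.differentiable (by norm_num)
  have hcurl : ∀ p, curl (fun z => ε⁻¹ • W z) p = ε⁻¹ • curl W p := fun p => curl_const_smul (hW1 p) _
  have hε' : 0 < ε⁻¹ := inv_pos.2 hε
  have hd1 : ‖(EuclideanSpace.single (2 : Fin 3) (1:ℝ))‖ = 1 := by rw [EuclideanSpace.norm_eq]; simp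
  have main := hgate Rc hRc (EuclideanSpace.single 2 1) (EuclideanSpace.single 0 1) (EuclideanSpace.single 1 1) κ 0 B
    orthonormal_e3_e1_e2 hκ1 hκ2 (by norm_num) hBd htr hB (fun z => ε⁻¹ • W z) (hW3.const_smul _)
    (fun p => by rw [divergence_const_smul_apply (hW1 p), hdiv p, mul_zero])
    ⟨ε⁻¹ * A, fun y => by
      refine ⟨?_, ?_⟩
      · rw [norm_smul, Real.norm_eq_abs, abs_of_pos hε', mul_left_comm]
        exact mul_le_mul_of_nonneg_left (hA y).1 hε'.le
      · rw [hcurl, norm_smul, Real.norm_eq_abs, abs_of_pos hε', mul_left_comm]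
        exact mul_le_mul_of_nonneg_left (hA y).2 hε'.le⟩
    (fun τ => by
      obtain ⟨h0, h1, h2⟩ := hmom τ
      refine ⟨?_, ?_, ?_⟩
      · simp_rw [hcurl, real_inner_smul_left, integral_const_mul, h0, mul_zero]
      · simp_rw [hcurl, real_inner_smul_left, mul_left_comm _ ε⁻¹, integral_const_mul, h1, mul_zero]
      · simp_rw [hcurl, real_inner_smul_left, mul_left_comm _ ε⁻¹, integral_const_mul, h2, mul_zero])
    (fun y => by
      rw [colForceVort_const_smul B 0 (κ - 3/2) Rc ε⁻¹ _ hW3, norm_smul, Real.norm_eq_abs, abs_of_pos hε', mul_left_comm]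
      calc ε⁻¹ * (secWt (EuclideanSpace.single 2 1) y ^ 2 * ‖colForceVort B 0 (κ - 3/2) Rc (EuclideanSpace.single 2 1) W y‖)
          ≤ ε⁻¹ * ε := mul_le_mul_of_nonneg_left (hforce y) hε'.le
        _ = 1 := inv_mul_cancel₀ hε.ne')
    y₀
  -- contradiction at `y₀`
  rw [hcurl, norm_smul, Real.norm_eq_abs, abs_of_pos hε', mul_left_comm] at main
  have h2 : ε⁻¹ ≤ ε⁻¹ * (secWt (EuclideanSpace.single 2 1) y₀ ^ 2 * ‖curl W y₀‖) := le_mul_of_one_le_right hε'.le hy₀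
  have h3 : ε⁻¹ = 2 * (C * Rc ^ q) := by rw [hε_def, one_div, inv_inv]
  linarith

end Summit.NavierStokesRegularity.NavierStokesRegularity.Theorems.DefectColumnGate

end
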